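import Summits.Ventures.PercRepro.Night2LocalR1ColB

/-!
# PercRepro — R1 columns, III: a collinear triple on a line missing one point; lines through a point (night-2, gen 10)

`U := S ∖ {y}` with four points, rank `3`, and a collinear triple `K₀ = U ∖ {z₀}` on the line `L = cl K₀`.
The covering coloops of `S` lie in `{y, z₀}` (`covZ_subset_pair`); a spreading member containing `y` has its pair
inside `K₀`, with `cl K = L` and `|P ∖ L| = 1` (`line_eq_of_mem_sprPre_mem`).

* `|P ∖ L| = 1` (`P = L ∪ {z₀}`): every spread vanishes — the side sums of the three triangles `{z₀, k, k′}` and of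
  the line members `{k, k′} ∪ {y}` are `≤ 5/12` by the uncounted-sides argument (`sideSum_le_of_subset_insert`), so
  `keepW = 5/12` — and the column is `≤ 5/12 + 5/12` (`sum_r1W_col_le_of_card_four_of_m_one`).

The second part collects the facts about lines through a point of a simple plane used by the case `|P ∖ L| ≥ 2`
(`Night2LocalR1ColD`): two distinct points span their line (`clF_pair_eq_of_mem_clF`), the side weight
`(5/4)/(|P ∖ cl K| + 2)` is monotone in `K`, the arithmetic `(5/4)/(a+2) + (5/4)/(b+2) ≤ 5/16 + (5/4)/n` for
`a, b ≥ 2`, `a + b ≥ n` (`two_sides_arith`), and **the two sides through `z₀`** (`two_sides_count`): the lines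
`cl {z₀, k}`, `cl {z₀, k′}` meet `L` only in `k`, `k′` and each other only in `z₀`, so they miss `≥ 2` points of
`P` each and `≥ |P|` points together.
-/

namespace PercRepro.Shadow

open Finset PerFlat ThmH

variable {α : Type*} [DecidableEq α] {M : Matroid α} [M.Finite]
/-! ## `|U| = 4`, a collinear triple on a line missing one point of `P` -/

/-- In the presence of a collinear triple `U ∖ {z₀}` (`U` of rank `3` with `4` points, simple), the covering
coloops of `S` lie in `{y, z₀}`. -/
theorem covZ_subset_pair {G : Finset α} (hsimple : ∀ e ∈ G, ∀ f ∈ G, e ≠ f → rkN M {e, f} = 2) {y : α}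
    (hycl : y ∉ clF M (G.erase y)) {S : Finset α} (hS : S ∈ shadowAt M 5 3 (Uq M 5 3) G) (hyS : y ∈ S)
    (hr : rkN M (S.erase y) = 3) (h4 : (S.erase y).card = 4) {z₀ : α} (hz₀ : z₀ ∈ S.erase y)
    (hz₀r : rkN M ((S.erase y).erase z₀) ≤ 2) : covZ M G S ⊆ {y, z₀} := by
  intro z hz
  rw [Finset.mem_insert, Finset.mem_singleton]
  by_cases hzy : z = y
  · exact Or.inl hzy
  · right
    exact eq_of_rkN_erase_le_two
      (simple_of_subset hsimple ((Finset.erase_subset _ _).trans (subset_of_mem_shadowAt hS))) hr (by omega)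
      (Finset.mem_erase.2 ⟨hzy, mem_of_mem_covZ hz⟩) hz₀ (rkN_erase_le_two_of_mem_covZ hycl hS hyS hz hzy) hz₀r

/-- A spreading member containing `y`, at a set with the collinear triple `U ∖ {z₀}`: its pair `K` lies in
`U ∖ {z₀}`, has the same closure, and that line misses exactly one point of `P`. -/
theorem line_eq_of_mem_sprPre_mem {G : Finset α} (hG : G ∈ flatsQ M 4)
    (hsimple : ∀ e ∈ G, ∀ f ∈ G, e ≠ f → rkN M {e, f} = 2) {y : α} (hyG : y ∈ G)
    (hycl : y ∉ clF M (G.erase y)) {S : Finset α} (hS : S ∈ shadowAt M 5 3 (Uq M 5 3) G)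
    (h4 : (S.erase y).card = 4) {z₀ : α} (hz₀ : z₀ ∈ S.erase y)
    (hz₀r : rkN M ((S.erase y).erase z₀) ≤ 2) {B : Finset α} (hB : B ∈ sprPre M G S) (hyB : y ∈ B) :
    B.erase y ⊆ (S.erase y).erase z₀ ∧ clF M (B.erase y) = clF M ((S.erase y).erase z₀) ∧
      ((G.erase y) \ clF M ((S.erase y).erase z₀)).card = 1 := by
  have hr : rkN M (S.erase y) = 3 := rkN_erase_of_mem_shadowAt hG hyG hycl hS
  obtain ⟨hKU, hK2, hKr, hKm, x, hxU, hxsub, hxr⟩ := line_of_mem_sprPre_mem hG hyG hycl hS h4 hB hyB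
  have hUsimple := simple_of_subset hsimple ((Finset.erase_subset y S).trans (subset_of_mem_shadowAt hS))
  have hxz : x = z₀ := eq_of_rkN_erase_le_two hUsimple hr (by omega) hxU hz₀ hxr hz₀r
  subst hxz
  -- `x ∉ K`: otherwise `U ⊆ cl K`
  have hxK : x ∉ B.erase y := by
    intro hxK
    have hUcl : S.erase y ⊆ clF M (B.erase y) := by
      intro e he
      by_cases hex : e = x
      · rw [hex]; exact subset_clF_of_subset_gr (hKU.trans ((Finset.erase_subset _ _).trans
          (subset_gr_of_mem_shadowAt hS))) hxK
      · exact hxsub (Finset.mem_erase.2 ⟨hex, he⟩)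
    have := rkN_mono (M := M) hUcl
    rw [rkN_clF, hKr, hr] at this
    omega
  have hKsub : B.erase y ⊆ (S.erase y).erase x := fun e he =>
    Finset.mem_erase.2 ⟨fun h => hxK (h ▸ he), hKU he⟩
  have hK₀r : rkN M ((S.erase y).erase x) = 2 := by
    apply le_antisymm hxr
    have := rkN_mono (M := M) hKsub
    omega
  have hcl : clF M (B.erase y) = clF M ((S.erase y).erase x) :=
    clF_eq_clF_of_subset_of_rkN_two ((Finset.erase_subset _ _).trans ((Finset.erase_subset _ _).trans
      (subset_gr_of_mem_shadowAt hS))) hKsub hKr hK₀r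
  refine ⟨hKsub, hcl, ?_⟩
  rw [← hcl]; exact hKm

open scoped Classical in
/-- **A collinear triple on a line missing one point**: every spread vanishes and the column is `≤ 5/6`. -/
theorem sum_r1W_col_le_of_card_four_of_m_one {G : Finset α} (hG : G ∈ flatsQ M 4)
    (hsimple : ∀ e ∈ G, ∀ f ∈ G, e ≠ f → rkN M {e, f} = 2) {y : α} (hyG : y ∈ G)
    (hycl : y ∉ clF M (G.erase y)) {S : Finset α} (hS : S ∈ shadowAt M 5 3 (Uq M 5 3) G)
    (h4 : (S.erase y).card = 4) {z₀ : α} (hz₀ : z₀ ∈ S.erase y)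
    (hz₀r : rkN M ((S.erase y).erase z₀) ≤ 2)
    (hm : ((G.erase y) \ clF M ((S.erase y).erase z₀)).card = 1) :
    ∑ B ∈ membersIn M (Uq M 5 3) G, r1W M G B S ≤ 5 / 6 := by
  have hGg := (mem_flatsQ.1 hG).1
  have hyS := mem_of_mem_shadowAt_coloop hyG hycl hS
  have hSG := subset_of_mem_shadowAt hS
  have hU : S.erase y ⊆ G.erase y := erase_subset_erase_of_mem_shadowAt hS
  have hr : rkN M (S.erase y) = 3 := rkN_erase_of_mem_shadowAt hG hyG hycl hS
  have hsd : (G.erase y) \ clF M ((S.erase y).erase z₀) = {z₀} :=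
    sdiff_clF_eq_singleton_of_m_one hGg hU hr hz₀ hz₀r hm
  have hz₀y : z₀ ≠ y := (Finset.mem_erase.1 hz₀).1
  have hK₀G : (S.erase y).erase z₀ ⊆ G := (Finset.erase_subset _ _).trans ((Finset.erase_subset _ _).trans hSG)
  have hK₀r : rkN M ((S.erase y).erase z₀) = 2 :=
    rkN_eq_two_of_le_two hsimple hK₀G (by rw [Finset.card_erase_of_mem hz₀]; omega) hz₀r
  rw [sum_r1W_col_eq hS]
  -- the covering part: at most two coloops, each `≤ 5/12`
  have hcov : ∑ z ∈ covZ M G S, covW M G (S.erase z) ≤ 5 / 6 := by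
    have hZ := covZ_subset_pair hsimple hycl hS hyS hr h4 hz₀ hz₀r
    have hc : (covZ M G S).card ≤ 2 := by
      calc (covZ M G S).card ≤ ({y, z₀} : Finset α).card := Finset.card_le_card hZ
        _ = 2 := Finset.card_pair (Ne.symm hz₀y)
    calc ∑ z ∈ covZ M G S, covW M G (S.erase z) ≤ ∑ z ∈ covZ M G S, (5 / 12 : ℚ) :=
          Finset.sum_le_sum (fun z hz => covW_erase_le hG hz)
      _ = (5 / 12) * ((covZ M G S).card : ℚ) := by rw [Finset.sum_const, nsmul_eq_mul]; ring
      _ ≤ (5 / 12) * 2 := by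
          have : ((covZ M G S).card : ℚ) ≤ 2 := by exact_mod_cast hc
          gcongr
      _ = 5 / 6 := by norm_num
  -- the spread part vanishes
  have hspr : ∀ B ∈ sprPre M G S, (5 / 12 - keepW M G B) / ((G.card - 4 : ℕ) : ℚ) = 0 := by
    intro B hB
    have hBm : B ∈ membersIn M (Uq M 5 3) G := (Finset.mem_filter.1 hB).1
    have hB3 : B.card = 3 := (Finset.mem_filter.1 hB).2.2.1
    have hBg : B ⊆ gr M := subset_gr_of_member hBm
    have hclB : clF M B ⊆ G := (mem_membersIn.1 hBm).2
    have hside : sideSum M G B ≤ 5 / 12 := by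
      by_cases hyB : y ∈ B
      · obtain ⟨hKsub, hcl, -⟩ := line_eq_of_mem_sprPre_mem hG hsimple hyG hycl hS h4 hz₀ hz₀r hB hyB
        have hKU : B.erase y ⊆ G.erase y := hKsub.trans ((Finset.erase_subset _ _).trans hU)
        have hsdB : G \ clF M B = {z₀} := by
          conv_lhs => rw [← Finset.insert_erase hyB]
          rw [sdiff_clF_insert_coloop hG hyG hycl hKU, hcl, hsd]
        apply sideSum_le_of_subset_insert hBg hB3 (rkN_eq_three_of_member hBm) hclB hsdB hyB
        intro e he
        rw [Finset.mem_insert]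
        by_cases hey : e = y
        · exact Or.inl hey
        · right
          have heG : e ∈ G.erase y := Finset.mem_erase.2 ⟨hey, hclB he⟩
          have hez : e ≠ z₀ := by
            rintro rfl
            have : e ∈ G \ clF M B := hsdB ▸ Finset.mem_singleton_self e
            exact (Finset.mem_sdiff.1 this).2 he
          rw [hcl]
          by_contra hecl
          have : e ∈ (G.erase y) \ clF M ((S.erase y).erase z₀) := Finset.mem_sdiff.2 ⟨heG, hecl⟩
          rw [hsd, Finset.mem_singleton] at this
          exact hez this
      · obtain ⟨x, hxU, hBx, hBr⟩ := eq_erase_of_mem_sprPre_notMem hyS h4 hB hyB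
        have hxz : x ≠ z₀ := by
          rintro rfl
          rw [hBx] at hBr
          omega
        have hz₀B : z₀ ∈ B := by rw [hBx]; exact Finset.mem_erase.2 ⟨Ne.symm hxz, hz₀⟩
        have hBsub : B ⊆ G.erase y := by rw [hBx]; exact (Finset.erase_subset _ _).trans hU
        have hsdB : G \ clF M B = {y} := sdiff_clF_eq_singleton_of_rkN_three hG hyG hycl hBsub hBr
        apply sideSum_le_of_subset_insert hBg hB3 hBr hclB hsdB hz₀B
        rw [clF_eq_erase_of_rkN_three hG hyG hycl hBsub hBr, hBx, Finset.erase_right_comm]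
        have hxK₀ : x ∈ (S.erase y).erase z₀ := Finset.mem_erase.2 ⟨hxz, hxU⟩
        have hpair : clF M (((S.erase y).erase z₀).erase x) = clF M ((S.erase y).erase z₀) := by
          apply clF_eq_clF_of_subset_of_rkN_two (hK₀G.trans hGg) (Finset.erase_subset _ _) _ hK₀r
          apply rkN_eq_two_of_card_two hsimple ((Finset.erase_subset _ _).trans hK₀G)
          rw [Finset.card_erase_of_mem hxK₀, Finset.card_erase_of_mem hz₀, h4]
        rw [hpair]
        exact erase_subset_insert_of_sdiff_eq hsd
    rw [keepW_eq_of_le G B (hside.trans (by norm_num))]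
    simp
  rw [Finset.sum_eq_zero hspr, add_zero]
  exact hcov


/-! ## Lines through a point -/

/-- A point `z₀` of a rank-`3` set `U` with `rk (U ∖ {z₀}) ≤ 2` lies outside `cl (U ∖ {z₀})`. -/
theorem notMem_clF_erase_of_rkN_three {U : Finset α} (hUg : U ⊆ gr M) (hr : rkN M U = 3) {z₀ : α}
    (hz₀r : rkN M (U.erase z₀) ≤ 2) : z₀ ∉ clF M (U.erase z₀) := by
  intro h
  have hsub : U ⊆ clF M (U.erase z₀) := by
    intro e he
    by_cases hez : e = z₀
    · rw [hez]; exact h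
    · exact subset_clF_of_subset_gr ((Finset.erase_subset _ _).trans hUg) (Finset.mem_erase.2 ⟨hez, he⟩)
  have := rkN_mono (M := M) hsub
  rw [rkN_clF] at this
  omega

/-- Two distinct (simple) points of a line span it: `e ≠ f` in `cl K` with `rk K = 2` give `cl {e, f} = cl K`. -/
theorem clF_pair_eq_of_mem_clF {G K : Finset α} (hsimple : ∀ e ∈ G, ∀ f ∈ G, e ≠ f → rkN M {e, f} = 2)
    (hKr : rkN M K = 2) {e f : α} (he : e ∈ G) (hf : f ∈ G) (hef : e ≠ f) (heK : e ∈ clF M K)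
    (hfK : f ∈ clF M K) : clF M {e, f} = clF M K := by
  have hLg : clF M K ⊆ gr M := by
    rw [← Finset.coe_subset, coe_clF, coe_gr]; exact M.closure_subset_ground _
  have hsub : ({e, f} : Finset α) ⊆ clF M K := by
    intro g hg
    rw [Finset.mem_insert, Finset.mem_singleton] at hg
    rcases hg with rfl | rfl
    · exact heK
    · exact hfK
  have hLr : rkN M (clF M K) = 2 := by rw [rkN_clF, hKr]
  rw [clF_eq_clF_of_subset_of_rkN_two hLg hsub (hsimple e he f hf hef) hLr, clF_clF]

/-- The side weight `(5/4)/(|P ∖ cl K| + 2)` is monotone in `K`. -/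
theorem side_weight_mono {P K K' : Finset α} (h : K ⊆ K') :
    (5 / 4 : ℚ) / (((P \ clF M K).card : ℚ) + 2) ≤ (5 / 4) / (((P \ clF M K').card : ℚ) + 2) := by
  apply div_le_div_of_nonneg_left (by norm_num) (by positivity)
  have : (P \ clF M K').card ≤ (P \ clF M K).card :=
    Finset.card_le_card (Finset.sdiff_subset_sdiff (Finset.Subset.refl _) (clF_mono h))
  have h' : ((P \ clF M K').card : ℚ) ≤ ((P \ clF M K).card : ℚ) := by exact_mod_cast this
  linarith

/-- `(5/4)/(a + 2) + (5/4)/(b + 2) ≤ 5/16 + (5/4)/n` for `a, b ≥ 2` and `a + b ≥ n ≥ 1`. -/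
theorem two_sides_arith {a b n : ℕ} (ha : 2 ≤ a) (hb : 2 ≤ b) (hn : n ≤ a + b) (hn1 : 1 ≤ n) :
    (5 / 4 : ℚ) / ((a : ℚ) + 2) + (5 / 4) / ((b : ℚ) + 2) ≤ 5 / 16 + (5 / 4) / (n : ℚ) := by
  have ha' : (2 : ℚ) ≤ a := by exact_mod_cast ha
  have hb' : (2 : ℚ) ≤ b := by exact_mod_cast hb
  have hn' : (n : ℚ) ≤ a + b := by exact_mod_cast hn
  have hn1' : (1 : ℚ) ≤ n := by exact_mod_cast hn1
  have h1 : (5 / 4 : ℚ) / ((a : ℚ) + 2) + (5 / 4) / ((b : ℚ) + 2) ≤ 5 / 16 + (5 / 4) / ((a : ℚ) + b) := by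
    rw [div_add_div _ _ (by linarith) (by linarith), div_add_div _ _ (by norm_num) (by linarith),
      div_le_div_iff₀ (by positivity) (by positivity)]
    nlinarith [mul_nonneg (sub_nonneg.2 ha') (sub_nonneg.2 hb')]
  have h2 : (5 / 4 : ℚ) / ((a : ℚ) + b) ≤ (5 / 4) / (n : ℚ) :=
    div_le_div_of_nonneg_left (by norm_num) (by linarith) hn'
  linarith

/-- **The two sides through `z₀`.**  `K₀ ⊆ P` collinear (`rk K₀ = 2`, `|K₀| = 3`) with line `L = cl K₀`, `P` closed
(`cl P = P`, simple), `z₀ ∈ P ∖ L`, `k ≠ k′` in `K₀`: the lines `cl {z₀, k}` and `cl {z₀, k′}` each miss `≥ 2`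
points of `P`, and together they miss `≥ |P|` points (counted with multiplicity): `|P ∖ cl {z₀, k}| +
|P ∖ cl {z₀, k′}| ≥ |P|`. -/
theorem two_sides_count {G P : Finset α} (hsimple : ∀ e ∈ G, ∀ f ∈ G, e ≠ f → rkN M {e, f} = 2)
    (hPG : P ⊆ G) (hPcl : clF M P = P) {K₀ : Finset α} (hK₀P : K₀ ⊆ P) (hK₀3 : K₀.card = 3)
    (hK₀r : rkN M K₀ = 2) {z₀ : α} (hz₀P : z₀ ∈ P) (hz₀L : z₀ ∉ clF M K₀) {k k' : α} (hk : k ∈ K₀)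
    (hk' : k' ∈ K₀) (hkk' : k ≠ k') :
    2 ≤ (P \ clF M {z₀, k}).card ∧ 2 ≤ (P \ clF M {z₀, k'}).card ∧
      P.card ≤ (P \ clF M {z₀, k}).card + (P \ clF M {z₀, k'}).card := by
  have hPg : P ⊆ gr M := by
    rw [← hPcl, ← Finset.coe_subset, coe_clF, coe_gr]; exact M.closure_subset_ground _
  have hclP : ∀ X ⊆ P, clF M X ⊆ P := fun X hX => by rw [← hPcl]; exact clF_mono hX
  have hkP : k ∈ P := hK₀P hk
  have hk'P : k' ∈ P := hK₀P hk'
  have hkL : k ∈ clF M K₀ := subset_clF_of_subset_gr (hK₀P.trans hPg) hk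
  have hk'L : k' ∈ clF M K₀ := subset_clF_of_subset_gr (hK₀P.trans hPg) hk'
  have hz₀k : z₀ ≠ k := fun h => hz₀L (h ▸ hkL)
  have hz₀k' : z₀ ≠ k' := fun h => hz₀L (h ▸ hk'L)
  set L := clF M K₀ with hL
  set L₁ := clF M {z₀, k} with hL₁
  set L₂ := clF M {z₀, k'} with hL₂
  have hL₁P : L₁ ⊆ P := hclP _ (by
    intro e he; rw [Finset.mem_insert, Finset.mem_singleton] at he; rcases he with rfl | rfl <;> assumption)
  have hL₂P : L₂ ⊆ P := hclP _ (by
    intro e he; rw [Finset.mem_insert, Finset.mem_singleton] at he; rcases he with rfl | rfl <;> assumption)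
  have hLP : L ⊆ P := hclP _ hK₀P
  have hz₀L₁ : z₀ ∈ L₁ := subset_clF_of_subset_gr (by
    intro e he; rw [Finset.mem_insert, Finset.mem_singleton] at he
    rcases he with rfl | rfl <;> exact hPg ‹_›) (Finset.mem_insert_self _ _)
  have hz₀L₂ : z₀ ∈ L₂ := subset_clF_of_subset_gr (by
    intro e he; rw [Finset.mem_insert, Finset.mem_singleton] at he
    rcases he with rfl | rfl <;> exact hPg ‹_›) (Finset.mem_insert_self _ _)
  have hkL₁ : k ∈ L₁ := subset_clF_of_subset_gr (by
    intro e he; rw [Finset.mem_insert, Finset.mem_singleton] at he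
    rcases he with rfl | rfl <;> exact hPg ‹_›) (Finset.mem_insert_of_mem (Finset.mem_singleton_self _))
  have hk'L₂ : k' ∈ L₂ := subset_clF_of_subset_gr (by
    intro e he; rw [Finset.mem_insert, Finset.mem_singleton] at he
    rcases he with rfl | rfl <;> exact hPg ‹_›) (Finset.mem_insert_of_mem (Finset.mem_singleton_self _))
  have hr₁ : rkN M {z₀, k} = 2 := hsimple z₀ (hPG hz₀P) k (hPG hkP) hz₀k
  have hr₂ : rkN M {z₀, k'} = 2 := hsimple z₀ (hPG hz₀P) k' (hPG hk'P) hz₀k'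
  -- (b) `L₁ ∩ L ⊆ {k}` and `L₂ ∩ L ⊆ {k'}`
  have hmeet : ∀ e ∈ L₁, e ∈ L → e = k := by
    intro e he₁ heL
    by_contra hek
    have h1 : clF M {k, e} = L₁ :=
      clF_pair_eq_of_mem_clF hsimple hr₁ (hPG hkP) (hPG (hL₁P he₁)) (Ne.symm hek) hkL₁ he₁
    have h2 : clF M {k, e} = L :=
      clF_pair_eq_of_mem_clF hsimple hK₀r (hPG hkP) (hPG (hL₁P he₁)) (Ne.symm hek) hkL heL
    exact hz₀L (h2 ▸ h1.symm ▸ hz₀L₁)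
  have hmeet' : ∀ e ∈ L₂, e ∈ L → e = k' := by
    intro e he₂ heL
    by_contra hek
    have h1 : clF M {k', e} = L₂ :=
      clF_pair_eq_of_mem_clF hsimple hr₂ (hPG hk'P) (hPG (hL₂P he₂)) (Ne.symm hek) hk'L₂ he₂
    have h2 : clF M {k', e} = L :=
      clF_pair_eq_of_mem_clF hsimple hK₀r (hPG hk'P) (hPG (hL₂P he₂)) (Ne.symm hek) hk'L heL
    exact hz₀L (h2 ▸ h1.symm ▸ hz₀L₂)
  -- (c) `L₁ ∩ L₂ ⊆ {z₀}`
  have hmeet₁₂ : ∀ e ∈ L₁, e ∈ L₂ → e = z₀ := by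
    intro e he₁ he₂
    by_contra hez
    have h1 : clF M {z₀, e} = L₁ :=
      clF_pair_eq_of_mem_clF hsimple hr₁ (hPG hz₀P) (hPG (hL₁P he₁)) (Ne.symm hez) hz₀L₁ he₁
    have h2 : clF M {z₀, e} = L₂ :=
      clF_pair_eq_of_mem_clF hsimple hr₂ (hPG hz₀P) (hPG (hL₂P he₂)) (Ne.symm hez) hz₀L₂ he₂
    have hk'L₁ : k' ∈ L₁ := by rw [← h1, h2]; exact hk'L₂
    exact hkk' (hmeet k' hk'L₁ hk'L).symm
  -- (d) `L₁ ⊆ (P ∖ L) ∪ {k}`, `L₂ ⊆ (P ∖ L) ∪ {k'}`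
  have hsub₁ : L₁ ⊆ (P \ L) ∪ {k} := by
    intro e he
    rw [Finset.mem_union, Finset.mem_sdiff, Finset.mem_singleton]
    by_cases heL : e ∈ L
    · exact Or.inr (hmeet e he heL)
    · exact Or.inl ⟨hL₁P he, heL⟩
  have hsub₂ : L₂ ⊆ (P \ L) ∪ {k'} := by
    intro e he
    rw [Finset.mem_union, Finset.mem_sdiff, Finset.mem_singleton]
    by_cases heL : e ∈ L
    · exact Or.inr (hmeet' e he heL)
    · exact Or.inl ⟨hL₂P he, heL⟩
  have hsub₁₂ : L₁ ∪ L₂ ⊆ (P \ L) ∪ {k, k'} := by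
    intro e he
    rw [Finset.mem_union] at he
    rw [Finset.mem_union, Finset.mem_insert, Finset.mem_singleton]
    rcases he with he | he
    · rcases Finset.mem_union.1 (hsub₁ he) with h | h
      · exact Or.inl h
      · exact Or.inr (Or.inl (Finset.mem_singleton.1 h))
    · rcases Finset.mem_union.1 (hsub₂ he) with h | h
      · exact Or.inl h
      · exact Or.inr (Or.inr (Finset.mem_singleton.1 h))
  have hinter : L₁ ∩ L₂ ⊆ {z₀} := by
    intro e he
    rw [Finset.mem_inter] at he
    rw [Finset.mem_singleton]
    exact hmeet₁₂ e he.1 he.2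
  -- the cards
  have hc₁ : L₁.card ≤ (P \ L).card + 1 := by
    calc L₁.card ≤ ((P \ L) ∪ {k}).card := Finset.card_le_card hsub₁
      _ ≤ (P \ L).card + ({k} : Finset α).card := Finset.card_union_le _ _
      _ = (P \ L).card + 1 := by rw [Finset.card_singleton]
  have hc₂ : L₂.card ≤ (P \ L).card + 1 := by
    calc L₂.card ≤ ((P \ L) ∪ {k'}).card := Finset.card_le_card hsub₂
      _ ≤ (P \ L).card + ({k'} : Finset α).card := Finset.card_union_le _ _
      _ = (P \ L).card + 1 := by rw [Finset.card_singleton]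
  have hc₁₂ : L₁.card + L₂.card ≤ (P \ L).card + 3 := by
    have hu : (L₁ ∪ L₂).card ≤ (P \ L).card + 2 := by
      calc (L₁ ∪ L₂).card ≤ ((P \ L) ∪ {k, k'}).card := Finset.card_le_card hsub₁₂
        _ ≤ (P \ L).card + ({k, k'} : Finset α).card := Finset.card_union_le _ _
        _ = (P \ L).card + 2 := by rw [Finset.card_pair hkk']
    have hi : (L₁ ∩ L₂).card ≤ 1 := by
      calc (L₁ ∩ L₂).card ≤ ({z₀} : Finset α).card := Finset.card_le_card hinter
        _ = 1 := Finset.card_singleton _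
    have := Finset.card_union_add_card_inter L₁ L₂
    omega
  have hL3 : 3 ≤ L.card := by
    calc 3 = K₀.card := hK₀3.symm
      _ ≤ L.card := Finset.card_le_card (subset_clF_of_subset_gr (hK₀P.trans hPg))
  have hPL := Finset.card_sdiff_add_card_eq_card hLP
  have hPL₁ := Finset.card_sdiff_add_card_eq_card hL₁P
  have hPL₂ := Finset.card_sdiff_add_card_eq_card hL₂P
  omega

end PercRepro.Shadow
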